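import Summits.KontsevichZagierPeriods.KontsevichZagierPeriods.Theses.FermatIsogeny
import Summits.KontsevichZagierPeriods.KontsevichZagierPeriods.Theorems.SymplecticScissorsRealOnePeriodRelationsConditional
import Summits.KontsevichZagierPeriods.KontsevichZagierPeriods.Theorems.RealOnePeriodRelations.Negative.Kit
import Literature.NumberTheory.Transcendental.CurvePeriods
import Literature.NumberTheory.Transcendental.KZCalculus

/-!
# `BetaLinearSector` (stmt-KontsevichZagierPeriods-3897) from Huber–Wüstholz and Green — the containing line `hw-real-transport`

Crux (route FermatIsogeny, rank 3): for positive rationals `a b a' b'` and a real algebraic `c`, two one-dimensional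
Kontsevich–Zagier representations pinned on `(0,1)` as `[t^{a-1}(1-t)^{b-1}]` and `[c·t^{a'-1}(1-t)^{b'-1}]` with the same value
are KZ-equivalent.

This support file records the TRANSFER from the sibling crux `SymplecticScissors.RealOnePeriodRelations` (stmt-10042), whose
composition `realOnePeriodRelations_of_huberWustholzCurvePeriods : HuberWustholzCurvePeriods → RealOnePeriodRelations` is landed
(`Theorems/SymplecticScissorsRealOnePeriodRelationsConditional.lean`): given

* the Literature named fact `HuberWustholzCurvePeriods` (Huber–Wüstholz 2022, Thm 13.3 (2): every vanishing `ℚ̄`-combination of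
  curve-type period symbols is a `ℚ̄`-combination of the elementary relations (R1)–(R5)), and
* the Green lemma `greenSet ⊆ KZ.relations` (every instance of the typed Green generator of stmt-10042 — `[∫A(t,0)] + [∫(B−A)(1−t,t)]
  − [∫B(0,t)]` for `A da + B db` with a `C¹` potential on the open standard triangle — is a chain of moves; the registered Green stubs
  of line `fermat-sector-transport` of this crux and of crux `PlanarAreas`, stmt-4990),

ANY two one-dimensional representations with equal values are KZ-equivalent (`equivalent_of_value_eq`): `[r] − [r'] ∈ H₁` has
`eval = 0`, hence lies in `M₁ = closure (1a ∪ 1b ∪ 2 ∪ Green)` by `RealOnePeriodRelations`, and `M₁ ≤ relations` by Green.  The crux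
is the instance "beta cells" (`BetaLinearSector_of_subs`, the registered anchor).  Nothing of the beta shape is used; the theorem
is CONDITIONAL on the two hypotheses (no `sorry`, no new axiom) and credits nothing by itself — it fixes the terminal status of
the crux as `blocked-on: Literature.NumberTheory.Transcendental.HuberWustholzCurvePeriods` once Green lands.

References: A. Huber, G. Wüstholz, *Transcendence and linear relations of 1-periods* (2022), Thm 13.3 (2); M. Kontsevich,
D. Zagier, *Periods* (2001), §1.2.
-/

noncomputable section

namespace Summit.KontsevichZagierPeriods.FermatIsogeny.BetaLinearSector

open Literature.NumberTheory.Transcendental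
open Summit.KontsevichZagierPeriods.SymplecticScissors.RealOnePeriodRelationsNegative (greenSet M₁ H₁ crux_iff)
open Summit.KontsevichZagierPeriods.KontsevichZagierPeriods.Theses.FermatIsogeny (BetaLinearSector)

/-- `M₁ = closure (1a ∪ 1b ∪ 2 ∪ Green) ≤ KZ.relations` as soon as the Green generator lies in the relations (the three other
generator sets are move sets). [cite: KontsevichZagier2001, §1.2] -/
theorem M₁_le_relations_of_green
    (hG : ∀ g ∈ Summit.KontsevichZagierPeriods.SymplecticScissors.RealOnePeriodRelationsNegative.greenSet,
      g ∈ Literature.NumberTheory.Transcendental.KZ.relations) :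
    M₁ ≤ KZ.relations := by
  refine (AddSubgroup.closure_le _).mpr ?_
  rintro c (((hc | hc) | hc) | hc)
  · exact KZ.domainAddRel_subset_relations hc
  · exact KZ.integrandAddRel_subset_relations hc
  · exact KZ.changeOfVariablesRel_subset_relations hc
  · exact hG c hc

/-- **Conjecture 1 for ALL pairs of one-dimensional representations, from Huber–Wüstholz and Green**: Huber–Wüstholz for
curve-type periods gives `RealOnePeriodRelations` (landed composition of stmt-10042), so `[r] − [r'] ∈ M₁` whenever
`r.value = r'.value`; and `M₁ ≤ relations` by Green. [cite: HuberWustholz2022, Thm 13.3 (2)] -/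
theorem equivalent_of_value_eq (hHW : Literature.NumberTheory.Transcendental.HuberWustholzCurvePeriods)
    (hG : ∀ g ∈ Summit.KontsevichZagierPeriods.SymplecticScissors.RealOnePeriodRelationsNegative.greenSet,
      g ∈ Literature.NumberTheory.Transcendental.KZ.relations)
    (r r' : KZ.IntegralRep 1) (hv : r.value = r'.value) : KZ.Equivalent r r' := by
  have hR := crux_iff.mp
    (Summit.KontsevichZagierPeriods.SymplecticScissors.RealOnePeriodRelations.realOnePeriodRelations_of_huberWustholzCurvePeriods
      hHW)
  have hmem : KZ.of r - KZ.of r' ∈ H₁ :=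
    H₁.sub_mem (AddSubgroup.subset_closure ⟨r, rfl⟩) (AddSubgroup.subset_closure ⟨r', rfl⟩)
  have heval : KZ.eval (KZ.of r - KZ.of r') = 0 := by
    rw [map_sub, KZ.eval_of, KZ.eval_of, hv, sub_self]
  exact M₁_le_relations_of_green hG (hR _ hmem heval)

/-- **The crux from Huber–Wüstholz and Green** (line `hw-real-transport` of crux stmt-3897, contained in line
`fermat-sector-transport`; registered anchor `BetaLinearSector_of_subs`): `HuberWustholzCurvePeriods → (greenSet ⊆ relations) →
BetaLinearSector`. CONDITIONAL on both hypotheses. [cite: HuberWustholz2022, Thm 13.3 (2)] -/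
theorem BetaLinearSector_of_subs : Literature.NumberTheory.Transcendental.HuberWustholzCurvePeriods →
    (∀ g ∈ Summit.KontsevichZagierPeriods.SymplecticScissors.RealOnePeriodRelationsNegative.greenSet,
      g ∈ Literature.NumberTheory.Transcendental.KZ.relations) →
    Summit.KontsevichZagierPeriods.KontsevichZagierPeriods.Theses.FermatIsogeny.BetaLinearSector := by
  intro hHW hG a b a' b' c _ _ _ _ _ r r' _ _ _ _ hv
  exact equivalent_of_value_eq hHW hG r r' hv

end Summit.KontsevichZagierPeriods.FermatIsogeny.BetaLinearSector

end
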